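import Summits.Ventures.DiscreteObjects.UnitDistance.PlaneUpperBoundSeven
import Mathlib.Combinatorics.Compactness
import HarnessLib

/-!
# de Bruijn–Erdős for the plane: target (U) is EXACTLY `χ(ℝ²) ≥ 6` (kernel), inside the kernel range `5 ≤ χ(ℝ²) ≤ 7`

Framing (verbatim for the cell): lottery ticket; floor = certified bounds/negative ranges.

`SixChromatic.lean` states target (U) as the existence of a finite unit-distance graph that is not 5-colourable and proves the easy
direction `SixChromaticUnitDistanceGraphExists → 6 ≤ χ(ℝ²)`.  Here the converse (de Bruijn–Erdős 1951, via Rado's selection principle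
`Finset.rado_selection_subtype` of Mathlib — compactness of `V → Fin k`): a graph all of whose finite induced subgraphs are `k`-colourable is
`k`-colourable (`colorable_of_forall_finset`), hence `planeUnitDistanceGraph.Colorable k ↔` every finite point set is `k`-colourable, and
**`sixChromatic_iff : SixChromaticUnitDistanceGraphExists ↔ 6 ≤ planeUnitDistanceGraph.chromaticNumber`**.  With `plane_chromaticNumber_bounds`
(`5 ≤ χ(ℝ²) ≤ 7`, `PlaneLowerBoundFive` / `PlaneUpperBoundSeven`) the census target is thus precisely the open middle value of the kernel range
(`target_U_status`).  Classical results; formalisation the cell's (seat udg g9); uses `Classical.choice` (standard axiom).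
-/

namespace Summit.Ventures.DiscreteObjects.UnitDistance

open SimpleGraph

/-- DE BRUIJN–ERDŐS (colouring form): if every finite induced subgraph of `G` is `k`-colourable then `G` is `k`-colourable. -/
theorem colorable_of_forall_finset {V : Type*} (G : SimpleGraph V) (k : ℕ)
    (h : ∀ s : Finset V, (G.induce (s : Set V)).Colorable k) : G.Colorable k := by
  classical
  let g : (s : Finset V) → (a : s) → Fin k := fun s a => (h s).some ⟨a.1, a.2⟩
  obtain ⟨χ, hχ⟩ := Finset.rado_selection_subtype (β := fun _ : V => Fin k) g
  refine ⟨Coloring.mk χ ?_⟩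
  intro u v huv
  obtain ⟨t, hst, ht⟩ := hχ {u, v}
  have hu : u ∈ ({u, v} : Finset V) := by simp
  have hv : v ∈ ({u, v} : Finset V) := by simp
  rw [ht ⟨u, hu⟩, ht ⟨v, hv⟩]
  exact (h t).some.valid (show (G.induce (t : Set V)).Adj ⟨u, hst hu⟩ ⟨v, hst hv⟩ from huv)

/-- A graph is `k`-colourable iff all its finite induced subgraphs are. -/
theorem colorable_iff_forall_finset {V : Type*} (G : SimpleGraph V) (k : ℕ) :
    G.Colorable k ↔ ∀ s : Finset V, (G.induce (s : Set V)).Colorable k :=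
  ⟨fun hc s => hc.of_hom (Embedding.induce (s : Set V)).toHom, colorable_of_forall_finset G k⟩

/-- A finite point set `s ⊆ ℝ²` whose unit-distance graph is not `k`-colourable yields a witness in the census format
(vertex type `Fin n`, injective realisation). -/
theorem exists_realisation_of_finset {k : ℕ} (s : Finset (EuclideanSpace ℝ (Fin 2)))
    (hs : ¬ (planeUnitDistanceGraph.induce (s : Set (EuclideanSpace ℝ (Fin 2)))).Colorable k) :
    ∃ (n : ℕ) (G : SimpleGraph (Fin n)) (p : Fin n → EuclideanSpace ℝ (Fin 2)),
      IsUnitDistanceRealisation G p ∧ ¬ G.Colorable k := by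
  classical
  let e : Fin s.card ≃ s := s.equivFin.symm
  let p : Fin s.card → EuclideanSpace ℝ (Fin 2) := fun i => (e i : EuclideanSpace ℝ (Fin 2))
  let G : SimpleGraph (Fin s.card) := planeUnitDistanceGraph.comap p
  refine ⟨s.card, G, p, ⟨?_, fun v w hvw => hvw⟩, ?_⟩
  · intro i j hij
    exact e.injective (Subtype.ext hij)
  · intro hG
    apply hs
    -- the induced graph on `s` maps homomorphically into `G` along `e.symm`
    let f : planeUnitDistanceGraph.induce (s : Set (EuclideanSpace ℝ (Fin 2))) →g G :=
      { toFun := fun x => e.symm ⟨x.1, x.2⟩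
        map_rel' := by
          intro x y hxy
          show planeUnitDistanceGraph.Adj (e (e.symm ⟨x.1, x.2⟩) : EuclideanSpace ℝ (Fin 2)) (e (e.symm ⟨y.1, y.2⟩))
          rw [Equiv.apply_symm_apply, Equiv.apply_symm_apply]
          exact hxy }
    exact hG.of_hom f

/-- TARGET (U) ⟺ the plane is not 5-colourable. -/
theorem sixChromatic_iff_not_colorable_five : SixChromaticUnitDistanceGraphExists ↔ ¬ planeUnitDistanceGraph.Colorable 5 := by
  constructor
  · rintro ⟨n, G, p, hp, hG⟩
    exact not_colorable_plane_of_realisation hp hG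
  · intro hno
    by_contra hne
    apply hno
    apply colorable_of_forall_finset
    intro s
    by_contra hs
    exact hne (exists_realisation_of_finset s hs)

/-- TARGET (U) ⟺ `χ(ℝ²) ≥ 6` (de Bruijn–Erdős direction added to `six_le_chromaticNumber_plane`). -/
theorem sixChromatic_iff : SixChromaticUnitDistanceGraphExists ↔ 6 ≤ planeUnitDistanceGraph.chromaticNumber := by
  refine ⟨six_le_chromaticNumber_plane, fun h6 => ?_⟩
  rw [sixChromatic_iff_not_colorable_five]
  intro hc
  have h5 : planeUnitDistanceGraph.chromaticNumber ≤ 5 := hc.chromaticNumber_le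
  have : (6 : ℕ∞) ≤ 5 := h6.trans h5
  exact absurd this (by decide)

/-- CENSUS STATUS OF TARGET (U), KERNEL: `5 ≤ χ(ℝ²) ≤ 7`, and the target (a finite 6-chromatic unit-distance graph) is equivalent to
`χ(ℝ²) ≥ 6` — the open middle of the range. -/
theorem target_U_status :
    (5 ≤ planeUnitDistanceGraph.chromaticNumber ∧ planeUnitDistanceGraph.chromaticNumber ≤ 7) ∧
      (SixChromaticUnitDistanceGraphExists ↔ 6 ≤ planeUnitDistanceGraph.chromaticNumber) :=
  ⟨plane_chromaticNumber_bounds, sixChromatic_iff⟩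

end Summit.Ventures.DiscreteObjects.UnitDistance
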